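import Summits.NavierStokesRegularity.NavierStokesRegularity.Theorems.ScenarioCensusRowF1Caged
import HarnessLib

/-!
# LINE «caged-top» port, part 2/2: the transfer (a porous top at a subcritical level kills the zoom limit); headlines `rowF1po_holds` …
# `rowF1cg_holds`, `solidTop_holds`, `topCaging_iff_rowF1`; census KEYS `Row_F1cg` / `Row_F1scg` / `Row_F1sl` / `Row_F1po` + `_excluded`

Re-homed for the scenario census (typer seat ns-census-typer-1 g7; the cells F1cg ⊆ F1scg ⊆ F1sl ⊆ F1po are MEMBERS OF RECORD «DECIDED IN KERNEL IN FILES» of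
row F1 since census v1.68 (critic idea-crit-3 PASS 18:50:08Z; ref ns-census-ref g8 PRE-CHECK ✓ §13.14 [2/6]: rev2 9b156507 = 43/43 decls identical to
47e154239c1ce73f; lit §21.20); this port makes them TREE-decided): VERBATIM PORT of ns-idea-3 LINE 14 «caged-top»,
`pub/ideators/ns-idea-3/lines/caged-top/line-caged-top.lean` sha16 9b156507ba7cf0a9 (628 l., lean check rc 0, 0 sorry), split for the 400-line rule
into `ScenarioCensusRowF1Caged` (§1–§2) → `ScenarioCensusRowF1CagedTop` (§3–§4 + census KEYS).  Lean text VERBATIM in namespace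
`…Theorems.ScenarioCensus.CagedTop` (the line's `…Cruxes.ScenarioCensusRowF1.CagedTopLine` re-homed); port edits: `@[conjecture]` on the residual
`TopCaging` (≡ `ScenarioCensus.Row_F1`, OPEN; obligation node), nothing else.

No census VALUE is moved here (row F1 stays OPEN-WITH-LINE; the members become TREE-decided by name); NS regularity is NOT proved; `Row_F1` is
untouched (zero movement, `topCaging_iff_rowF1`); no summit statement is proved by this file.
-/

-- the summit and its single problem share the name `NavierStokesRegularity` (D-0017 nested layout)
set_option linter.dupNamespace false

noncomputable section

open MeasureTheory Set Function Filter TopologicalSpace Metric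
open scoped Topology NNReal ENNReal InnerProductSpace RealInnerProductSpace

namespace Summit.NavierStokesRegularity.NavierStokesRegularity.Theorems.ScenarioCensus.CagedTop

open Literature.Analysis Literature.Analysis.FluidPDE
open Summit.NavierStokesRegularity.NavierStokesRegularity.Theorems
open Summit.NavierStokesRegularity.NavierStokesRegularity.Theorems.LocalSineTubeDoorProfileAlignedWindowRigidityAncient
  (analyticOnNhd_slice bdd_of_hasTypeITimeDecay)

/-! ## §3 The transfer: a porous top at a subcritical level kills the zoom limit -/

/-- **Porous transfer** (the new step): if the zooms `(c_j α) u(T + c_j² β t, x₀ + c_j R ·)` converge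
pointwise on the open past to `W ∈ 𝒦_C` and the top of `u` is porous at a subcritical level, then every
slice `W(t, ·)`, `t < 0`, vanishes.  For: a nonzero value `W(t, y)` comes from `Λ`-top points at the
physical times `τ_j = T + c_j² β t` (the level is subcritical, `‖u‖ ≳ 1/c_j` there); their pores, rescaled
(`c_j` cancels), are balls of the FIXED radius `a √(ν β (−t)) / R` with centres in a FIXED compact ball
around `y`; at a cluster centre `ζ⋆` the limit vanishes on a ball (a nonzero `W(t, y')` would make
`x₀ + c_j R y'` a top point inside a pore), so the analytic slice vanishes identically — contradiction. -/
theorem slice_eq_zero_of_porous {ν T : ℝ} (hν : 0 < ν) {u : ℝ → E3 → E3} {x₀ : E3}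
    {C α β R : ℝ} {c : ℕ → ℝ} {W : ℝ → E3 → E3}
    (hα : 0 < α) (hβ : 0 < β) (hR : 0 < R) (hcpos : ∀ j, 0 < c j) (hclim : Tendsto c atTop (𝓝 0))
    (hW : IsTypeIAncientMild C W)
    (hpt : ∀ t < 0, ∀ y : E3,
      Tendsto (fun j => (c j * α) • u (T + c j ^ 2 * β * t) (x₀ + (c j * R) • y)) atTop (𝓝 (W t y)))
    {Λ : ℝ → ℝ} {A a : ℝ} (hΛ : IsSubcriticalLevel T Λ) (ha : 0 < a)
    (hpor : HasPorousTopAt ν T Λ A a u) :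
    ∀ t < 0, ∀ y, W t y = 0 := by
  intro t ht
  have ht' : 0 < -t := neg_pos.2 ht
  -- the physical times `τ_j ↑ T` and the parabolic radius there, `√(ν (T - τ_j)) = c_j s`
  have hτlim : Tendsto (fun j => T + c j ^ 2 * β * t) atTop (𝓝 T) := by
    have h : Tendsto (fun j => T + c j ^ 2 * β * t) atTop (𝓝 (T + 0 ^ 2 * β * t)) :=
      (((hclim.pow 2).mul_const β).mul_const t).const_add T
    rw [zero_pow two_ne_zero, zero_mul, zero_mul, add_zero] at h
    exact h
  have hτT : ∀ j : ℕ, T + c j ^ 2 * β * t < T := by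
    intro j
    have : 0 < c j ^ 2 * β := mul_pos (pow_pos (hcpos j) 2) hβ
    nlinarith
  have hτwithin : Tendsto (fun j => T + c j ^ 2 * β * t) atTop (𝓝[<] T) :=
    tendsto_nhdsWithin_iff.2 ⟨hτlim, Eventually.of_forall hτT⟩
  set s : ℝ := Real.sqrt (ν * β * (-t)) with hs
  have hs0 : 0 < s := Real.sqrt_pos.2 (mul_pos (mul_pos hν hβ) ht')
  have hsqrtτ : ∀ j : ℕ, Real.sqrt (T - (T + c j ^ 2 * β * t)) = c j * Real.sqrt (β * (-t)) := by
    intro j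
    have e : T - (T + c j ^ 2 * β * t) = c j ^ 2 * (β * (-t)) := by ring
    rw [e, Real.sqrt_mul (sq_nonneg _), Real.sqrt_sq (hcpos _).le]
  have hsqrtντ : ∀ j : ℕ, Real.sqrt (ν * (T - (T + c j ^ 2 * β * t))) = c j * s := by
    intro j
    have e : ν * (T - (T + c j ^ 2 * β * t)) = c j ^ 2 * (ν * β * (-t)) := by ring
    rw [e, Real.sqrt_mul (sq_nonneg _), Real.sqrt_sq (hcpos _).le]
  -- points of the limit where `W ≠ 0` come from `Λ`-top points, eventually (subcritical level)
  have htop : ∀ y : E3, W t y ≠ 0 →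
      ∀ᶠ j in atTop, Λ (T + c j ^ 2 * β * t) < ‖u (T + c j ^ 2 * β * t) (x₀ + (c j * R) • y)‖ := by
    intro y hne
    have hpos : 0 < ‖W t y‖ := norm_pos_iff.2 hne
    have hβt : 0 < Real.sqrt (β * (-t)) := Real.sqrt_pos.2 (by positivity)
    have f1 : ∀ᶠ j in atTop, ‖W t y‖ / 2 < ‖(c j * α) • u (T + c j ^ 2 * β * t) (x₀ + (c j * R) • y)‖ :=
      ((hpt t ht y).norm).eventually_const_lt (by linarith)
    have hg : Tendsto (fun j => Λ (T + c j ^ 2 * β * t) * (c j * α)) atTop (𝓝 0) := by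
      have h := (hΛ.comp hτwithin).mul_const (α / Real.sqrt (β * (-t)))
      rw [zero_mul] at h
      refine h.congr fun j => ?_
      show Λ (T + c j ^ 2 * β * t) * Real.sqrt (T - (T + c j ^ 2 * β * t)) *
          (α / Real.sqrt (β * (-t))) = Λ (T + c j ^ 2 * β * t) * (c j * α)
      rw [hsqrtτ j]
      have hs' : Real.sqrt (β * (-t)) ≠ 0 := hβt.ne'
      calc Λ (T + c j ^ 2 * β * t) * (c j * Real.sqrt (β * (-t))) * (α / Real.sqrt (β * (-t)))
          = Λ (T + c j ^ 2 * β * t) * (c j * α) *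
              (Real.sqrt (β * (-t)) / Real.sqrt (β * (-t))) := by ring
        _ = Λ (T + c j ^ 2 * β * t) * (c j * α) := by rw [div_self hs', mul_one]
    have f2 : ∀ᶠ j in atTop, Λ (T + c j ^ 2 * β * t) * (c j * α) < ‖W t y‖ / 2 :=
      hg.eventually_lt_const (by linarith)
    filter_upwards [f1, f2] with j hj1 hj2
    have hcαj : 0 < c j * α := mul_pos (hcpos _) hα
    rw [norm_smul, Real.norm_eq_abs, abs_of_pos hcαj] at hj1
    have hlt : Λ (T + c j ^ 2 * β * t) * (c j * α) <
        ‖u (T + c j ^ 2 * β * t) (x₀ + (c j * R) • y)‖ * (c j * α) := by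
      rw [mul_comm (‖u _ _‖)]
      linarith
    exact lt_of_mul_lt_mul_right hlt hcαj.le
  -- suppose a nonzero value `W t y`
  by_contra hcon
  push Not at hcon
  obtain ⟨y, hy⟩ := hcon
  obtain ⟨N, hN⟩ := eventually_atTop.1 (hτwithin.eventually hpor)
  obtain ⟨N₁, hN₁⟩ := eventually_atTop.1 (htop y hy)
  -- rescaled pores around `y`, from the index `M` on
  set M : ℕ := max N N₁ with hM
  have hpore : ∀ j, M ≤ j → ∃ ζ : E3, ‖ζ - y‖ ≤ A * s / R ∧
      ∀ y' : E3, ‖y' - ζ‖ < a * s / R →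
        ‖u (T + c j ^ 2 * β * t) (x₀ + (c j * R) • y')‖ ≤ Λ (T + c j ^ 2 * β * t) := by
    intro j hj
    obtain ⟨z, hz1, hz2⟩ := hN j (le_of_max_le_left hj) _ (hN₁ j (le_of_max_le_right hj))
    have hcR : 0 < c j * R := mul_pos (hcpos j) hR
    have hc0 : c j ≠ 0 := (hcpos j).ne'
    rw [hsqrtντ j] at hz1
    refine ⟨(c j * R)⁻¹ • (z - x₀), ?_, fun y' hy' => hz2 _ ?_⟩
    · have e1 : (c j * R)⁻¹ • (z - x₀) - y = (c j * R)⁻¹ • (z - (x₀ + (c j * R) • y)) := by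
        simp only [smul_sub, smul_add, inv_smul_smul₀ hcR.ne']
        abel
      rw [e1, norm_smul, Real.norm_eq_abs, abs_of_pos (inv_pos.2 hcR)]
      calc (c j * R)⁻¹ * ‖z - (x₀ + (c j * R) • y)‖ ≤ (c j * R)⁻¹ * (A * (c j * s)) :=
            mul_le_mul_of_nonneg_left hz1 (inv_pos.2 hcR).le
        _ = A * s / R := by field_simp
    · have e2 : x₀ + (c j * R) • y' - z = (c j * R) • (y' - (c j * R)⁻¹ • (z - x₀)) := by
        rw [smul_sub, smul_inv_smul₀ hcR.ne']
        abel
      rw [e2, norm_smul, Real.norm_eq_abs, abs_of_pos hcR, hsqrtντ j]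
      calc c j * R * ‖y' - (c j * R)⁻¹ • (z - x₀)‖ < c j * R * (a * s / R) :=
            mul_lt_mul_of_pos_left hy' hcR
        _ = a * (c j * s) := by field_simp
  choose! ζ hζ using hpore
  -- a cluster centre `ζ⋆` (compactness of the closed ball)
  have hmem : ∀ k, ζ (k + M) ∈ closedBall y (A * s / R) := fun k =>
    mem_closedBall_iff_norm.2 (hζ (k + M) (Nat.le_add_left M k)).1
  obtain ⟨ζs, -, ψ, hψ, hlim⟩ := (isCompact_closedBall y (A * s / R)).tendsto_subseq hmem
  have hidx : Tendsto (fun k => ψ k + M) atTop atTop :=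
    (tendsto_add_atTop_nat M).comp hψ.tendsto_atTop
  -- `W t` vanishes on the ball of radius `a s / (2R)` around `ζ⋆`
  have hρ : 0 < a * s / R / 2 := by positivity
  have hzero : ∀ y' ∈ ball ζs (a * s / R / 2), W t y' = 0 := by
    intro y' hy'
    by_contra hne
    have f1 := hidx.eventually (htop y' hne)
    have f2 : ∀ᶠ k in atTop, dist (ζ (ψ k + M)) ζs < a * s / R / 2 :=
      (Metric.tendsto_nhds.1 hlim) _ hρ
    obtain ⟨k, hk1, hk2⟩ := (f1.and f2).exists
    have hclose : ‖y' - ζ (ψ k + M)‖ < a * s / R := by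
      have h1 : ‖y' - ζs‖ < a * s / R / 2 := mem_ball_iff_norm.1 hy'
      rw [dist_eq_norm, ← norm_neg, neg_sub] at hk2
      calc ‖y' - ζ (ψ k + M)‖ = ‖(y' - ζs) + (ζs - ζ (ψ k + M))‖ := by congr 1; abel
        _ ≤ ‖y' - ζs‖ + ‖ζs - ζ (ψ k + M)‖ := norm_add_le _ _
        _ < a * s / R / 2 + a * s / R / 2 := add_lt_add h1 hk2
        _ = a * s / R := by ring
    have hle := (hζ (ψ k + M) (Nat.le_add_left M _)).2 y' hclose
    exact absurd hk1 (not_lt.2 hle)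
  exact hy (slice_eq_zero_of_eqOn_ball hW ht hρ hzero y)

/-! ## §4 Headlines -/

/-- **Criterion row F1po is EXCLUDED** (in kernel; the master row): a classical Leray–Hopf solution from a
rapidly decaying datum with at most the Type-I rate at `T` whose top above some subcritical moving level is
eventually POROUS (every fast point has a fast-free pore of radius `a √(ν (T − t))` within distance
`A √(ν (T − t))`) extends smoothly past `T`.  Proof: at a would-be backward-singular point the singular zoom
package (`exists_singularZoom_package`) gives a nontrivial `W ∈ 𝒦_C`, every slice of which the porous
transfer (`slice_eq_zero_of_porous`) annihilates; hence every point has a bounded backward cylinder and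
Lemarié-Rieusset's Thm 15.1 (C) extends `u`.
(refs: LemarieRieusset2016, Thm 9.12 and Thm 15.1 (C); AlbrittonBarker2019, §3;
KochNadirashviliSereginSverak2009, Lemma 6.1 and §6) -/
theorem rowF1po_holds : Row_F1po := by
  intro ν T hν hT u p hsol hLH hdec hTI hcg
  obtain ⟨Λ, A, a, hΛ, ha, hpor⟩ := hcg
  apply hasSmoothExtensionPast_of_forall_exists_parabolicCylinder hν hT hsol hLH hdec
  intro x₀
  by_contra hno
  have hsing : ∀ r : ℝ, 0 < r →
      eLpNorm (uncurry u) ∞ (volume.restrict (parabolicCylinder r ((T : ℝ), x₀))) = ∞ := by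
    intro r hr
    by_contra h
    exact hno ⟨r, hr, lt_top_iff_ne_top.2 h⟩
  obtain ⟨C, α, β, R, c, W, hα, hβ, hR, hcpos, hclim, hW, hpt, t, ht, y, hne⟩ :=
    exists_singularZoom_package hν hT hsol hLH hdec hTI x₀ hsing
  exact hne (slice_eq_zero_of_porous hν hα hβ hR hcpos hclim hW hpt hΛ ha hpor t ht y)

/-- **Criterion row F1sl is EXCLUDED** (in kernel; corollary of `rowF1po_holds`). -/
theorem rowF1sl_holds : Row_F1sl := rowF1sl_of_rowF1po rowF1po_holds

/-- **Criterion row F1scg is EXCLUDED** (in kernel; corollary of `rowF1sl_holds`). -/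
theorem rowF1scg_holds : Row_F1scg := rowF1scg_of_rowF1sl rowF1sl_holds

/-- **Criterion row F1cg is EXCLUDED** (in kernel; corollary of `rowF1scg_holds`). -/
theorem rowF1cg_holds : Row_F1cg := rowF1cg_of_rowF1scg rowF1scg_holds

/-- **SOLID TOP** (structural theorem, in kernel): a maximal classical Leray–Hopf solution from a rapidly
decaying datum which blows up at `T` at the Type-I rate has NO porous top. -/
theorem solidTop_holds : SolidTop :=
  fun ν T hν hT u p hmax hLH hdec hTI hcg =>
    hmax.2 (rowF1po_holds ν T hν hT u p hmax.1 hLH hdec hTI hcg)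

/-- No Type-I Clay blow-up has a slab-caged top. -/
theorem not_hasSlabCagedTop_of_typeI : ∀ (ν T : ℝ), 0 < ν → 0 < T →
    ∀ (u : ℝ → E3 → E3) (p : ℝ → E3 → ℝ),
    IsMaximalSmoothSolution ν 0 u p T → IsLerayHopfOn T ν 0 (u 0) u →
    HasRapidSpatialDecay (u 0) → IsTypeIBlowup u T → ¬ HasSlabCagedTop ν T u :=
  fun ν T hν hT u p hmax hLH hdec hTI hcg =>
    solidTop_holds ν T hν hT u p hmax hLH hdec hTI hcg.hasPorousTop

/-- No Type-I Clay blow-up has a (subcritically) caged top. -/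
theorem not_hasSubcriticallyCagedTop_of_typeI : ∀ (ν T : ℝ), 0 < ν → 0 < T →
    ∀ (u : ℝ → E3 → E3) (p : ℝ → E3 → ℝ),
    IsMaximalSmoothSolution ν 0 u p T → IsLerayHopfOn T ν 0 (u 0) u →
    HasRapidSpatialDecay (u 0) → IsTypeIBlowup u T → ¬ HasSubcriticallyCagedTop ν T u :=
  fun ν T hν hT u p hmax hLH hdec hTI hcg =>
    not_hasSlabCagedTop_of_typeI ν T hν hT u p hmax hLH hdec hTI hcg.hasSlabCagedTop

/-- No Type-I Clay blow-up has a caged top. -/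
theorem not_hasCagedTop_of_typeI : ∀ (ν T : ℝ), 0 < ν → 0 < T →
    ∀ (u : ℝ → E3 → E3) (p : ℝ → E3 → ℝ),
    IsMaximalSmoothSolution ν 0 u p T → IsLerayHopfOn T ν 0 (u 0) u →
    HasRapidSpatialDecay (u 0) → IsTypeIBlowup u T → ¬ HasCagedTop ν T u :=
  fun ν T hν hT u p hmax hLH hdec hTI hcg =>
    not_hasSubcriticallyCagedTop_of_typeI ν T hν hT u p hmax hLH hdec hTI hcg.hasSubcriticallyCagedTop

/-- **SOLID TOP, unfolded** (the display form, constant levels): in the maximal Type-I Clay frame, for EVERY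
level `Λ`, ALL `A`, `a > 0` and EVERY `t₁ < T` there are a time `t ∈ (t₁, T)` and a `Λ`-fast point `x` such
that EVERY ball of radius `a √(ν (T − t))` centred within `A √(ν (T − t))` of `x` contains a `Λ`-fast point —
the top is parabolically `a`-dense in a parabolic `A`-ball, for every `A`, arbitrarily close to `T`. -/
theorem solidTop_unfolded : ∀ (ν T : ℝ), 0 < ν → 0 < T →
    ∀ (u : ℝ → E3 → E3) (p : ℝ → E3 → ℝ),
    IsMaximalSmoothSolution ν 0 u p T → IsLerayHopfOn T ν 0 (u 0) u →
    HasRapidSpatialDecay (u 0) → IsTypeIBlowup u T →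
    ∀ (Λ A a t₁ : ℝ), 0 < a → t₁ < T → ∃ t ∈ Ioo t₁ T, ∃ x : E3, Λ < ‖u t x‖ ∧
      ∀ z : E3, ‖z - x‖ ≤ A * Real.sqrt (ν * (T - t)) →
        ∃ x' : E3, ‖x' - z‖ < a * Real.sqrt (ν * (T - t)) ∧ Λ < ‖u t x'‖ := by
  intro ν T hν hT u p hmax hLH hdec hTI Λ A a t₁ ha ht₁
  by_contra hno
  push Not at hno
  refine solidTop_holds ν T hν hT u p hmax hLH hdec hTI
    ⟨fun _ => Λ, A, a, isSubcriticalLevel_const T Λ, ha, ?_⟩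
  exact eventually_of_mem (Ioo_mem_nhdsLT ht₁) fun t ht => hno t ht

/-- **TOP ESCAPE from slabs, unfolded**: for every `Λ`, `A`, `t₁ < T` there is a time `t ∈ (t₁, T)` at
which, in EVERY unit direction `e`, two `Λ`-fast points have `|⟪x − x', e⟫| > A √(ν (T − t))` — the top of a
Type-I Clay blow-up is parabolically thick in all directions (no points, no filaments, no sheets). -/
theorem slabEscape_unfolded : ∀ (ν T : ℝ), 0 < ν → 0 < T →
    ∀ (u : ℝ → E3 → E3) (p : ℝ → E3 → ℝ),
    IsMaximalSmoothSolution ν 0 u p T → IsLerayHopfOn T ν 0 (u 0) u →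
    HasRapidSpatialDecay (u 0) → IsTypeIBlowup u T →
    ∀ (Λ A t₁ : ℝ), t₁ < T → ∃ t ∈ Ioo t₁ T, ∀ e : E3, ‖e‖ = 1 → ∃ x x' : E3,
      Λ < ‖u t x‖ ∧ Λ < ‖u t x'‖ ∧ A * Real.sqrt (ν * (T - t)) < |⟪x - x', e⟫| := by
  intro ν T hν hT u p hmax hLH hdec hTI Λ A t₁ ht₁
  by_contra hno
  push Not at hno
  refine not_hasSlabCagedTop_of_typeI ν T hν hT u p hmax hLH hdec hTI
    ⟨fun _ => Λ, A, isSubcriticalLevel_const T Λ, ?_⟩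
  exact eventually_of_mem (Ioo_mem_nhdsLT ht₁) fun t ht => hno t ht

/-- **TOP ESCAPE from balls, unfolded**: for every `Λ`, `A`, `t₁ < T` there are `t ∈ (t₁, T)` and two
`Λ`-fast points farther apart than `A √(ν (T − t))`. -/
theorem ballEscape_unfolded : ∀ (ν T : ℝ), 0 < ν → 0 < T →
    ∀ (u : ℝ → E3 → E3) (p : ℝ → E3 → ℝ),
    IsMaximalSmoothSolution ν 0 u p T → IsLerayHopfOn T ν 0 (u 0) u →
    HasRapidSpatialDecay (u 0) → IsTypeIBlowup u T →
    ∀ (Λ A t₁ : ℝ), t₁ < T → ∃ t ∈ Ioo t₁ T, ∃ x x' : E3,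
      Λ < ‖u t x‖ ∧ Λ < ‖u t x'‖ ∧ A * Real.sqrt (ν * (T - t)) < ‖x - x'‖ := by
  intro ν T hν hT u p hmax hLH hdec hTI Λ A t₁ ht₁
  by_contra hno
  push Not at hno
  refine not_hasCagedTop_of_typeI ν T hν hT u p hmax hLH hdec hTI ⟨Λ, A, ?_⟩
  exact eventually_of_mem (Ioo_mem_nhdsLT ht₁) fun t ht x x' hx hx' => hno t ht x x' hx hx'

/-- **Row F1 ≡ TopCaging** (exact reformulation, in kernel): row F1 holds iff every Type-I Clay blow-up has
a caged top. -/
theorem topCaging_iff_rowF1 : TopCaging ↔ ScenarioCensus.Row_F1 :=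
  ⟨fun h => rowF1_of rowF1cg_holds h, topCaging_of_rowF1⟩

/-- **Composition concluding the target BY NAME**: `TopCaging → Row_F1`. -/
theorem rowF1_of_topCaging : TopCaging → ScenarioCensus.Row_F1 :=
  topCaging_iff_rowF1.1

end Summit.NavierStokesRegularity.NavierStokesRegularity.Theorems.ScenarioCensus.CagedTop

namespace Summit.NavierStokesRegularity.NavierStokesRegularity.Theorems.ScenarioCensus

/-! ## Census KEYS (ns `…Theorems.ScenarioCensus`): the CAGE family of row F1 — TREE-decided members -/

/-- **Cell F1cg** (row F1 frame VERBATIM + a BALL CAGE at a constant fast level ⇒ smooth extension past `T`): `:= CagedTop.Row_F1cg`. DECIDED. -/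
def Row_F1cg : Prop := CagedTop.Row_F1cg
/-- F1cg is EXCLUDED (decided in the tree): `CagedTop.rowF1cg_holds`. -/
theorem row_F1cg_excluded : Row_F1cg := CagedTop.rowF1cg_holds

/-- **Cell F1scg** (ball cage at a SUBCRITICAL moving level): `:= CagedTop.Row_F1scg`. DECIDED. -/
def Row_F1scg : Prop := CagedTop.Row_F1scg
/-- F1scg is EXCLUDED (decided in the tree): `CagedTop.rowF1scg_holds`. -/
theorem row_F1scg_excluded : Row_F1scg := CagedTop.rowF1scg_holds

/-- **Cell F1sl** (SLAB cage): `:= CagedTop.Row_F1sl`. DECIDED. -/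
def Row_F1sl : Prop := CagedTop.Row_F1sl
/-- F1sl is EXCLUDED (decided in the tree): `CagedTop.rowF1sl_holds`. -/
theorem row_F1sl_excluded : Row_F1sl := CagedTop.rowF1sl_holds

/-- **Cell F1po** (POROUS top): `:= CagedTop.Row_F1po`. DECIDED. -/
def Row_F1po : Prop := CagedTop.Row_F1po
/-- F1po is EXCLUDED (decided in the tree): `CagedTop.rowF1po_holds`. -/
theorem row_F1po_excluded : Row_F1po := CagedTop.rowF1po_holds

/-- **Floor SOLID TOP** at the level of the census keys: `CagedTop.solidTop_holds`. -/
theorem row_F1_solidTop : CagedTop.SolidTop := CagedTop.solidTop_holds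

end Summit.NavierStokesRegularity.NavierStokesRegularity.Theorems.ScenarioCensus

end
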